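import Summits.AtomisticToContinuum.HydrodynamicLimit.Theorems.RelayRaceLocalityRestartPrincipleOfNoAnomalousDissipation
import Summits.AtomisticToContinuum.HydrodynamicLimit.Theses.ImplosionDichotomy
import HarnessLib

/-!
# Crux `RestartPrinciple` (stmt-AtomisticToContinuum-12503), line `isentropic-regibbsification` —
# the residue S4a also closes the shared conjunct item `HydroLimitInBand` (stmt-AtomisticToContinuum-9133)

Lead c6. The single open stub of the line, S4a (`stub_noAnomalousDissipation`), implies the crux
`RestartPrinciple` (`restartPrinciple_of_noAnomalousDissipation`, p120172) by proving its CONSEQUENT `G`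
outright (`guardedConjunct_of_noAnomalousDissipation`). That consequent is, verbatim, the packing-guarded
hydrodynamic-limit conjunct `HydroLimitInBand` — the statement of the shared open item stmt-9133 (moot copy
stmt-3093), wanted by several routes (`GermanoSplitLES`, `LaxScheme`, …). This file records the implication
BY NAME for the `GermanoSplitLES` copy, so that the size of the promoted residue is visible on the ledger:
proving S4a settles stmt-9133 as well as stmt-12503. No definitions, no `sorry`.

Maintenance record (full-build repair, 2026-08-17; dependency drift, content unchanged). Route
`GermanoSplitLES` rev 5 (2026-08-16T23:18Z, route-repair after the Statement re-type p126922 / D-0032)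
DROPPED its copy of the shared support `HydroLimitInBand` (stmt-9133 ≡ 3093; the re-typed Statement
`_root_.HydrodynamicLimit` is verbatim that conjunct), so the gate-generated thesis module no longer
declares `Summit.AtomisticToContinuum.HydrodynamicLimit.Theses.GermanoSplitLES.HydroLimitInBand` and the
landed theorem `hydroLimitInBand_of_noAnomalousDissipation` (p124578), which names that identifier fully
qualified in its signature, stopped elaborating. Repair, append-only: (1) the dropped copy is RECORDED
below under its exact former name with the text VERBATIM (the ledger signature of stmt-9133, token-identical
to the live shared decl `Summit.AtomisticToContinuum.HydrodynamicLimit.Theses.ImplosionDichotomy.HydroLimitInBand`,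
checked by string comparison), so the landed theorem keeps its signature and proof byte-for-byte; the
import of `Theses.GermanoSplitLES` (now contributing nothing here) is replaced by `Theses.ImplosionDichotomy`;
(2) the same one-line proof is restated against the LIVE shared decl of stmt-9133,
`ImplosionDichotomy.HydroLimitInBand` (the item's canonical declaration on the ledger), as
`sharedHydroLimitInBand_of_noAnomalousDissipation`, so that "S4a settles stmt-9133" stays visible by name.
One record definition (not a cited fact, not a route item); still no `sorry`.
-/

noncomputable section

open Literature.MathematicalPhysics.KineticTheory Literature.Analysis.FluidPDE
open Literature.Analysis.FunctionSpaces MeasureTheory Filter Set Topology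
open scoped ENNReal

/-! ## Record of the dropped `GermanoSplitLES` copy of the shared support `HydroLimitInBand` (stmt-9133) -/

namespace Summit.AtomisticToContinuum.HydrodynamicLimit.Theses.GermanoSplitLES

/-- **RECORD of the dropped route copy `GermanoSplitLES.HydroLimitInBand`** (shared support
stmt-AtomisticToContinuum-9133 ≡ 3093; verbatim its ledger signature), under its former name. Route
`GermanoSplitLES` rev 5 (2026-08-16) dropped this copy when the re-typed Statement `_root_.HydrodynamicLimit`
absorbed its content; the item itself stays OPEN and shared (live copies: `ImplosionDichotomy.HydroLimitInBand`,
`LaxScheme`, `StrongClosureWeakBV`, …). The packing-guarded hydrodynamic-limit conjunct: there is `η₀ > 0`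
such that for all continuous positive profiles there is `σ₀ > 0` such that for `0 < σ < σ₀`, every classical
hard-sphere-Euler solution `(ρ, u, θ)` on `[0, T)` with `ρ_t(x)σ³ < η₀`, and every flow family whose local
Gibbs laws have the right hydrodynamic fields at `t = 0`, the hydrodynamic fields converge at every
`t ∈ [0, T)`. Kept here, token-identical to the live shared decl
`Summit.AtomisticToContinuum.HydrodynamicLimit.Theses.ImplosionDichotomy.HydroLimitInBand`, solely so that
the landed theorem `hydroLimitInBand_of_noAnomalousDissipation` below keeps elaborating unchanged (a record
definition, not a cited fact and not a route item). -/
def HydroLimitInBand : Prop :=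
  ∃ η₀ : ℝ, 0 < η₀ ∧ ∀ (a₀ θ₀ : Literature.MathematicalPhysics.KineticTheory.T3 → ℝ) (u₀ : Literature.MathematicalPhysics.KineticTheory.T3 → Literature.MathematicalPhysics.KineticTheory.V3), Continuous a₀ → Continuous θ₀ → Continuous u₀ → (∀ x, 0 < a₀ x) → (∀ x, 0 < θ₀ x) → ∃ σ₀ : ℝ, 0 < σ₀ ∧ ∀ σ : ℝ, 0 < σ → σ < σ₀ → ∀ (T : ℝ) (ρ θ : ℝ → Literature.MathematicalPhysics.KineticTheory.T3 → ℝ) (u : ℝ → Literature.MathematicalPhysics.KineticTheory.T3 → Literature.MathematicalPhysics.KineticTheory.V3), Literature.MathematicalPhysics.KineticTheory.IsHardSphereEulerSolution σ T ρ u θ → (∀ t ∈ Set.Ico 0 T, ∀ x, ρ t x * σ ^ 3 < η₀) → ∀ Φ : (N : ℕ) → Literature.Analysis.FluidPDE.HardSphereFlow (Literature.Analysis.FluidPDE.Torus.geometry (Fin 3)) (Literature.MathematicalPhysics.KineticTheory.hsDiameter σ N) (N + 1), Literature.MathematicalPhysics.KineticTheory.TendstoHydroFieldsAt (fun N => Literature.MathematicalPhysics.KineticTheory.localGibbsLaw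 σ a₀ u₀ θ₀ N (Φ N)) Φ ρ u θ 0 → ∀ t ∈ Set.Ico 0 T, Literature.MathematicalPhysics.KineticTheory.TendstoHydroFieldsAt (fun N => Literature.MathematicalPhysics.KineticTheory.localGibbsLaw σ a₀ u₀ θ₀ N (Φ N)) Φ ρ u θ t

end Summit.AtomisticToContinuum.HydrodynamicLimit.Theses.GermanoSplitLES

namespace Summit.AtomisticToContinuum.HydrodynamicLimit.Theorems.RestartPrinciple.IsentropicRegibbsification

/-- **S4a closes `HydroLimitInBand` (stmt-9133).** The registered stub S4a (`stub_noAnomalousDissipation`,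
the antecedent, verbatim) implies the route decl `GermanoSplitLES.HydroLimitInBand` — the packing-guarded
hydrodynamic-limit conjunct shared by the `HydrodynamicLimit` routes — through the landed composition
`guardedConjunct_of_noAnomalousDissipation` (restart induction in entropy currency).
[cite: Yau1991, §1; OllaVaradhanYau1993, §3] -/
theorem hydroLimitInBand_of_noAnomalousDissipation :
    (∃ η₀ : ℝ, 0 < η₀ ∧ ∃ σ₀ : ℝ, 0 < σ₀ ∧ ∀ σ : ℝ, 0 < σ → σ < σ₀ → ∀ M : ℝ, 0 < M →
      ∃ τ₁ : ℝ, 0 < τ₁ ∧ ∀ (T : ℝ) (ρ θ : ℝ → T3 → ℝ) (u : ℝ → T3 → V3),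
      IsHardSphereEulerSolution σ T ρ u θ → (∀ s' ∈ Set.Ico 0 T, ∫ x, ρ s' x = 1) →
      ∀ Φ : (N : ℕ) → HardSphereFlow (Torus.geometry (Fin 3)) (hsDiameter σ N) (N + 1),
      ∀ s ∈ Set.Ico 0 T, ∀ t ∈ Set.Ico s (min T (s + τ₁)),
      (∀ s' ∈ Set.Icc s t, ∀ x, ρ s' x * σ ^ 3 < η₀ ∧ ρ s' x ≤ M ∧ θ s' x ≤ M ∧ M⁻¹ ≤ θ s' x ∧
      ‖u s' x‖ ≤ M ∧ ∀ i j k : Fin 3, |Torus.partialDeriv i (ρ s') x| ≤ M ∧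
      ‖Torus.partialDeriv i (u s') x‖ ≤ M ∧ |Torus.partialDeriv i (θ s') x| ≤ M ∧
      |Torus.partialDeriv i (Torus.partialDeriv j (ρ s')) x| ≤ M ∧
      ‖Torus.partialDeriv i (Torus.partialDeriv j (u s')) x‖ ≤ M ∧
      |Torus.partialDeriv i (Torus.partialDeriv j (θ s')) x| ≤ M ∧
      |Torus.partialDeriv i (Torus.partialDeriv j (Torus.partialDeriv k (ρ s'))) x| ≤ M ∧
      ‖Torus.partialDeriv i (Torus.partialDeriv j (Torus.partialDeriv k (u s'))) x‖ ≤ M ∧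
      |Torus.partialDeriv i (Torus.partialDeriv j (Torus.partialDeriv k (θ s'))) x| ≤ M) →
      ∀ δ : ℝ, 0 < δ → ∃ C : ℝ, 0 < C ∧ ∀ N : ℕ,
      localGibbsLaw σ (fun x => ρ s x * Real.exp (hsExcessFreeEnergy (ρ s x * σ ^ 3) +
      ρ s x * σ ^ 3 * deriv hsExcessFreeEnergy (ρ s x * σ ^ 3))) (u s) (θ s) N (Φ N)
      {z | ((N : ℝ) + 1)⁻¹ * ∑ i, Real.log (localGibbsProfile
      (fun x => ρ t x * Real.exp (hsExcessFreeEnergy (ρ t x * σ ^ 3) +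
      ρ t x * σ ^ 3 * deriv hsExcessFreeEnergy (ρ t x * σ ^ 3))) (u t) (θ t)
      ((Φ N).flow (t - s) z i)) <
      (∫ x, ρ t x * (Real.log (ρ t x * Real.exp (hsExcessFreeEnergy (ρ t x * σ ^ 3) +
      ρ t x * σ ^ 3 * deriv hsExcessFreeEnergy (ρ t x * σ ^ 3))) -
      3 / 2 * Real.log (2 * Real.pi * θ t x) - 3 / 2)) - δ} ≤
      ENNReal.ofReal (C * Real.exp (-(C⁻¹ * (N + 1))))) →
    Summit.AtomisticToContinuum.HydrodynamicLimit.Theses.GermanoSplitLES.HydroLimitInBand :=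
  fun hNAD => guardedConjunct_of_noAnomalousDissipation hNAD

/-- **S4a closes the LIVE shared item `HydroLimitInBand` (stmt-9133), by name.** The registered stub S4a
(`stub_noAnomalousDissipation`, the antecedent, verbatim) implies
`ImplosionDichotomy.HydroLimitInBand` — the ledger's canonical declaration of the shared packing-guarded
hydrodynamic-limit conjunct stmt-9133 (the `GermanoSplitLES` copy targeted by
`hydroLimitInBand_of_noAnomalousDissipation` was dropped from its route on 2026-08-16 and survives above only
as a record) — through the landed composition `guardedConjunct_of_noAnomalousDissipation` (restart induction
in entropy currency); same proof term. [cite: Yau1991, §1; OllaVaradhanYau1993, §3] -/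
theorem sharedHydroLimitInBand_of_noAnomalousDissipation :
    (∃ η₀ : ℝ, 0 < η₀ ∧ ∃ σ₀ : ℝ, 0 < σ₀ ∧ ∀ σ : ℝ, 0 < σ → σ < σ₀ → ∀ M : ℝ, 0 < M →
      ∃ τ₁ : ℝ, 0 < τ₁ ∧ ∀ (T : ℝ) (ρ θ : ℝ → T3 → ℝ) (u : ℝ → T3 → V3),
      IsHardSphereEulerSolution σ T ρ u θ → (∀ s' ∈ Set.Ico 0 T, ∫ x, ρ s' x = 1) →
      ∀ Φ : (N : ℕ) → HardSphereFlow (Torus.geometry (Fin 3)) (hsDiameter σ N) (N + 1),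
      ∀ s ∈ Set.Ico 0 T, ∀ t ∈ Set.Ico s (min T (s + τ₁)),
      (∀ s' ∈ Set.Icc s t, ∀ x, ρ s' x * σ ^ 3 < η₀ ∧ ρ s' x ≤ M ∧ θ s' x ≤ M ∧ M⁻¹ ≤ θ s' x ∧
      ‖u s' x‖ ≤ M ∧ ∀ i j k : Fin 3, |Torus.partialDeriv i (ρ s') x| ≤ M ∧
      ‖Torus.partialDeriv i (u s') x‖ ≤ M ∧ |Torus.partialDeriv i (θ s') x| ≤ M ∧
      |Torus.partialDeriv i (Torus.partialDeriv j (ρ s')) x| ≤ M ∧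
      ‖Torus.partialDeriv i (Torus.partialDeriv j (u s')) x‖ ≤ M ∧
      |Torus.partialDeriv i (Torus.partialDeriv j (θ s')) x| ≤ M ∧
      |Torus.partialDeriv i (Torus.partialDeriv j (Torus.partialDeriv k (ρ s'))) x| ≤ M ∧
      ‖Torus.partialDeriv i (Torus.partialDeriv j (Torus.partialDeriv k (u s'))) x‖ ≤ M ∧
      |Torus.partialDeriv i (Torus.partialDeriv j (Torus.partialDeriv k (θ s'))) x| ≤ M) →
      ∀ δ : ℝ, 0 < δ → ∃ C : ℝ, 0 < C ∧ ∀ N : ℕ,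
      localGibbsLaw σ (fun x => ρ s x * Real.exp (hsExcessFreeEnergy (ρ s x * σ ^ 3) +
      ρ s x * σ ^ 3 * deriv hsExcessFreeEnergy (ρ s x * σ ^ 3))) (u s) (θ s) N (Φ N)
      {z | ((N : ℝ) + 1)⁻¹ * ∑ i, Real.log (localGibbsProfile
      (fun x => ρ t x * Real.exp (hsExcessFreeEnergy (ρ t x * σ ^ 3) +
      ρ t x * σ ^ 3 * deriv hsExcessFreeEnergy (ρ t x * σ ^ 3))) (u t) (θ t)
      ((Φ N).flow (t - s) z i)) <
      (∫ x, ρ t x * (Real.log (ρ t x * Real.exp (hsExcessFreeEnergy (ρ t x * σ ^ 3) +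
      ρ t x * σ ^ 3 * deriv hsExcessFreeEnergy (ρ t x * σ ^ 3))) -
      3 / 2 * Real.log (2 * Real.pi * θ t x) - 3 / 2)) - δ} ≤
      ENNReal.ofReal (C * Real.exp (-(C⁻¹ * (N + 1))))) →
    Summit.AtomisticToContinuum.HydrodynamicLimit.Theses.ImplosionDichotomy.HydroLimitInBand :=
  fun hNAD => guardedConjunct_of_noAnomalousDissipation hNAD

end Summit.AtomisticToContinuum.HydrodynamicLimit.Theorems.RestartPrinciple.IsentropicRegibbsification

end
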